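import Literature.MathematicalPhysics.StatisticalMechanics.NJLExponentialClustering
import Literature.MathematicalPhysics.StatisticalMechanics.NJLThermodynamicLimit
import Literature.MathematicalPhysics.StatisticalMechanics.ComplexSpinTwoPointThermodynamicLimit
import Literature.MathematicalPhysics.StatisticalMechanics.ComplexSpinMeanFieldBound
import HarnessLib

/-!
# The thermodynamic limit of the NJL two-point function at nonzero mass: Salmhofer–Seiler's
# Theorem 3.23 (2) in lattice form (CMP 139 (1991), Thm. 3.23 (2) (3.111))

Theorems only (no definition, no named fact).  Salmhofer–Seiler, Thm. 3.23 (2) p. 416: "For `ν ≥ 3`,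
in the thermodynamic limit of the NJL model at `m ≠ 0`, `T̂(k) = s²δ(k) + ĝ(k)` (3.111), where
`s = ⟨σ_x⟩`, `ĝ` is analytic for `|Im k_μ| < κ(m)`, and `ĝ` obeys the bound (3.109)."  Printed proof
(p. 417): "By Theorem 3.11, `⟨σ₀σ_x⟩ - ⟨σ₀⟩⟨σ_x⟩ = g(x)` clusters exponentially for `m ≠ 0`,
therefore its Fourier transform `ĝ` is analytic in `k` for `|Im k_μ| < κ(m)`. The `δ`-term in `T̂` is
the Fourier transform of the constant `s² = ⟨σ₀⟩⟨σ_x⟩`."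

With Thm. 3.8/Cor. 3.9 (`njl_thermodynamicLimit_real`: the limits exist along EVERY sequence of
volumes), Thm. 3.11 in the limit (`njl_twoPoint_exponentialClustering_limit`) and the lattice form of
Thm. 3.23 (1) (`thermodynamicLimit_twoPoint_decomp_of_hasLog`) in the tree, this file proves, for the
NJL system (`B(t) = e^{Nt}`, `N ≥ 1`; `N = 1` is strongly coupled lattice QED, Remark 3.4 (1)) at real
mass `m > 0`, `ν ≥ 3`, along any even tori `Λ_n = (ℤ/L_n)^ν → ∞`:

* **`njl_twoPoint_thermodynamicLimit`** — the two-point function `T_Λ(x) = ⟨σ₀σ_x⟩_Λ` and the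
  condensate `⟨σ_x⟩_Λ` converge (no subsequence), `T_{Λ_n}(x) → T(x)`, `⟨σ_x⟩_{Λ_n} → s`; the atoms of
  Thm. 3.23 (1) are `c₀ = s²` and `c_π̂ = 0` (`|Λ_n|⁻¹T̂_{Λ_n}(0) → s²`, `|Λ_n|⁻¹T̂_{Λ_n}(π̂) → 0`) —
  the lattice form of "`T̂ = s²δ + ĝ`"; and `g = T - s²` clusters exponentially,
  `|T(x) - s²| ≤ C(m) e^{-κ(m)|x_μ|}` for every coordinate `x_μ ≠ 0`, in particular `g(x) → 0` at
  infinity (the decay that makes `ĝ` analytic in a strip; the strip analyticity itself is not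
  restated here).

Honest framing: `β = 0` NJL complex spin systems on even tori and their pointwise limits; real
`m > 0` (Thm. 3.18's `m ≥ 0` for `|T_Λ| ≤ 1`, Thm. 3.11's `m ≠ 0`); nothing about `β > 0`, the
continuum, `SU(N)` or the summit's `QCD` conjunct.

## References

* M. Salmhofer, E. Seiler, *Proof of chiral symmetry breaking in strongly coupled lattice gauge
  theory*, Commun. Math. Phys. 139 (1991) 395–432: Thm. 3.23 (2) (3.111) and its proof p. 417;
  Thm. 3.8, Cor. 3.9, Thm. 3.11. [SalmhoferSeiler1991]
* M. Salmhofer, E. Seiler, Erratum, Commun. Math. Phys. 146 (1992) 637–638 (the `m`-dependent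
  prefactor of the clustering bound). [SalmhoferSeiler1992Erratum]
-/

noncomputable section

namespace Literature.MathematicalPhysics.StatisticalMechanics

namespace ComplexSpin

open MvPolynomial Finset Filter Topology
open Literature.Probability.LatticeModels

variable {ν : ℕ}

/-- `Torus.proj L 0 = 0`. [folklore] -/
private theorem torus_proj_zero'' (L : ℕ) : Torus.proj L (0 : Site ν) = 0 := by
  funext i; simp [Torus.proj]

/-- The two-site monomial read on the torus is `σ₀σ_{x̄}`. [folklore] -/
private theorem monomial_proj_pair' (L : ℕ) [NeZero L] (x : Site ν) :
    (monomial (Finsupp.mapDomain (Torus.proj L) (Finsupp.single (0 : Site ν) 1 + Finsupp.single x 1))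
      (1 : ℝ) : MvPolynomial (TorusSite ν L) ℝ) = X 0 * X (Torus.proj L x) := by
  rw [Finsupp.mapDomain_add, Finsupp.mapDomain_single, Finsupp.mapDomain_single, torus_proj_zero'',
    X, X, monomial_mul, mul_one]

/-- The one-site monomial read on the torus is `σ_{x̄}`. [folklore] -/
private theorem monomial_proj_single' (L : ℕ) [NeZero L] (x : Site ν) :
    (monomial (Finsupp.mapDomain (Torus.proj L) (Finsupp.single x 1)) (1 : ℝ) :
      MvPolynomial (TorusSite ν L) ℝ) = X (Torus.proj L x) := by
  rw [Finsupp.mapDomain_single, X]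

/-- Translation invariance of the condensate on the torus: `⟨σ_y⟩_Λ = ⟨σ_0⟩_Λ`.
[cite: SalmhoferSeiler1991, Def. 3.1 (torus) and (3.111) (s = ⟨σ_x⟩)] -/
theorem expect_X_translate {L : ℕ} [NeZero L] (N : ℕ) (m : ℝ) (a : ℕ → ℝ) (y : TorusSite ν L) :
    expect N m a (X y) = expect N m a (X (0 : TorusSite ν L)) := by
  rw [expect_eq_div, expect_eq_div, ← bracket_rename_addRight N m a y (X 0), rename_X, zero_add]

/-- A real nonzero mass lies in the zero-free mass region `ℂ ∖ i[-√(2ν), √(2ν)]`. [cite: SalmhoferSeiler1991, Thm. 3.6 and Cor. 3.9] -/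
theorem ofReal_mem_njlMassRegion {m : ℝ} (hm : m ≠ 0) : (m : ℂ) ∈ njlMassRegion ν := by
  left; rwa [Complex.ofReal_re]

/-- Points of `ℤ^ν` with all coordinates of absolute value `≤ R` form a finite set. [folklore] -/
private theorem finite_box (R : ℤ) : {x : Site ν | ∀ i, |x i| ≤ R}.Finite := by
  have h : {x : Site ν | ∀ i, |x i| ≤ R} = Set.pi Set.univ fun _ : Fin ν => Set.Icc (-R) R := by
    ext x
    simp only [Set.mem_setOf_eq, Set.mem_pi, Set.mem_univ, forall_true_left, Set.mem_Icc, abs_le]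
  rw [h]
  exact Set.Finite.pi fun _ => Set.finite_Icc _ _

/-- **Theorem 3.23 (2), lattice form (the NJL model at nonzero mass).**  For the NJL system
(`N ≥ 1`), `ν ≥ 3`, real `m > 0` and even tori `Λ_n = (ℤ/L_n)^ν` with `L_n → ∞`:
* (Cor. 3.9) `T_{Λ_n}(x) = ⟨σ₀σ_{x̄}⟩_{Λ_n} → T(x)` for every `x ∈ ℤ^ν` and `⟨σ_{x̄}⟩_{Λ_n} → s` (the
  condensate, the same for every `x`), along the whole sequence;
* (the atoms of Thm. 3.23 (1)) `|Λ_n|⁻¹ T̂_{Λ_n}(0) → s²` and `|Λ_n|⁻¹ T̂_{Λ_n}(π̂) → 0`: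
  `T̂ = s²δ + ĝ`, no mass at `π̂`;
* (Thm. 3.11 ⇒ regularity of `ĝ`) `|T(x) - s²| ≤ C e^{-κ|x_μ|}` for all `x` and `μ` with `x_μ ≠ 0`,
  some `κ = κ(m) > 0`, `C = C(m) ≥ 0`; hence `T(x) - s² → 0` as `|x| → ∞`.
[cite: SalmhoferSeiler1991, Thm. 3.23 (2) (3.111)][cite: SalmhoferSeiler1992Erratum, (1)–(2)] -/
theorem njl_twoPoint_thermodynamicLimit {N : ℕ} (hN : 1 ≤ N) (hν : 3 ≤ ν) {m : ℝ} (hm : 0 < m)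
    (Ls : ℕ → ℕ) [∀ n, NeZero (Ls n)] (hev : ∀ n, Even (Ls n)) (hLs : Tendsto Ls atTop atTop) :
    ∃ T : Site ν → ℝ, ∃ s : ℝ,
      (∀ x, Tendsto (fun n => corrFn (L := Ls n) N m (njlBondCoeff N) (Torus.proj (Ls n) x))
        atTop (nhds (T x))) ∧
      (∀ x : Site ν, Tendsto (fun n => expect (L := Ls n) N m (njlBondCoeff N)
        (X (Torus.proj (Ls n) x))) atTop (nhds s)) ∧
      Tendsto (fun n => zeroMode (ν := ν) (L := Ls n) N m (njlBondCoeff N)) atTop (nhds (s ^ 2)) ∧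
      Tendsto (fun n => stagMode (ν := ν) (L := Ls n) (hev n).two_dvd N m (njlBondCoeff N))
        atTop (nhds 0) ∧
      (∃ κ : ℝ, 0 < κ ∧ ∃ C : ℝ, 0 ≤ C ∧ ∀ (x : Site ν) (i : Fin ν), x i ≠ 0 →
        |T x - s ^ 2| ≤ C * Real.exp (-κ * |(x i : ℝ)|)) ∧
      Tendsto (fun x => T x - s ^ 2) cofinite (nhds 0) := by
  classical
  have hν1 : 1 ≤ ν := by omega
  have hm0 : m ≠ 0 := hm.ne'
  have hmem : (m : ℂ) ∈ njlMassRegion ν := ofReal_mem_njlMassRegion hm0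
  -- the complex correlations are the real ones
  have hpairC : ∀ (n : ℕ) (x : Site ν), njlCorrelation N (Ls n)
      (Finsupp.single (0 : Site ν) 1 + Finsupp.single x 1) (m : ℂ) =
      ((corrFn (L := Ls n) N m (njlBondCoeff N) (Torus.proj (Ls n) x) : ℝ) : ℂ) := by
    intro n x
    rw [njlCorrelation_ofReal, monomial_proj_pair']
    rfl
  have hsingleC : ∀ (n : ℕ) (x : Site ν), njlCorrelation N (Ls n) (Finsupp.single x 1) (m : ℂ) =
      ((expect (L := Ls n) N m (njlBondCoeff N) (X (Torus.proj (Ls n) x)) : ℝ) : ℂ) := by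
    intro n x
    rw [njlCorrelation_ofReal, monomial_proj_single']
  -- (Cor. 3.9) the two-point function converges
  have hT' : ∀ x : Site ν, ∃ t : ℝ,
      Tendsto (fun n => corrFn (L := Ls n) N m (njlBondCoeff N) (Torus.proj (Ls n) x))
        atTop (nhds t) := by
    intro x
    obtain ⟨f, -, hf⟩ := njl_thermodynamicLimit_real hN hν1 (Finsupp.single (0 : Site ν) 1 + Finsupp.single x 1)
    have h := hf Ls hLs m hm0
    simp_rw [hpairC] at h
    refine ⟨(f m).re, Tendsto.congr (fun n => ?_) ((Complex.continuous_re.tendsto _).comp h)⟩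
    simp only [Function.comp_apply, Complex.ofReal_re]
  choose T hT using hT'
  -- (Cor. 3.9) the condensate converges, to the same `s` for every site
  obtain ⟨f₁, -, hf₁⟩ := njl_thermodynamicLimit_real hN hν1 (Finsupp.single (0 : Site ν) 1)
  set s : ℝ := (f₁ m).re with hs
  have hS0 : Tendsto (fun n => expect (L := Ls n) N m (njlBondCoeff N) (X (0 : TorusSite ν (Ls n))))
      atTop (nhds s) := by
    have h := hf₁ Ls hLs m hm0
    simp_rw [hsingleC, torus_proj_zero''] at h
    refine Tendsto.congr (fun n => ?_) ((Complex.continuous_re.tendsto _).comp h)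
    simp only [Function.comp_apply, Complex.ofReal_re]
  have hS : ∀ x : Site ν, Tendsto (fun n => expect (L := Ls n) N m (njlBondCoeff N)
      (X (Torus.proj (Ls n) x))) atTop (nhds s) := by
    intro x
    refine hS0.congr fun n => ?_
    exact (expect_X_translate N m _ _).symm
  -- (Thm. 3.11 in the limit) exponential clustering of `T - s²`
  obtain ⟨κ, hκ, C, hC, hcl⟩ := njl_twoPoint_exponentialClustering_limit (ν := ν) hN hν1 hmem
  have hdecay : ∀ (x : Site ν) (i : Fin ν), x i ≠ 0 →
      |T x - s ^ 2| ≤ C * Real.exp (-κ * |(x i : ℝ)|) := by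
    intro x i hxi
    have ha : Tendsto (fun n => njlCorrelation N (Ls n) (Finsupp.single x 1 + Finsupp.single 0 1) (m : ℂ))
        atTop (nhds ((T x : ℝ) : ℂ)) := by
      simp_rw [add_comm (Finsupp.single x 1), hpairC]
      exact (Complex.continuous_ofReal.tendsto _).comp (hT x)
    have hb : Tendsto (fun n => njlCorrelation N (Ls n) (Finsupp.single x 1) (m : ℂ))
        atTop (nhds ((s : ℝ) : ℂ)) := by
      simp_rw [hsingleC]
      exact (Complex.continuous_ofReal.tendsto _).comp (hS x)
    have hc : Tendsto (fun n => njlCorrelation N (Ls n) (Finsupp.single (0 : Site ν) 1) (m : ℂ))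
        atTop (nhds ((s : ℝ) : ℂ)) := by
      simp_rw [hsingleC]
      exact (Complex.continuous_ofReal.tendsto _).comp (hS 0)
    have h := hcl x 0 i (by simpa using hxi) Ls hLs _ _ _ ha hb hc
    rw [← Complex.ofReal_mul, ← Complex.ofReal_sub, Complex.norm_real, Real.norm_eq_abs] at h
    simp only [Pi.zero_apply, sub_zero] at h
    rw [sq]
    refine h.trans_eq ?_
    rw [Nat.cast_natAbs, Int.cast_abs]
  -- hence `T - s² → 0` at infinity
  have hRL : Tendsto (fun x => T x - s ^ 2) cofinite (nhds 0) := by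
    rw [Metric.tendsto_nhds]
    intro ε hε
    -- choose `R` with `C e^{-κR} < ε`
    obtain ⟨R, hR⟩ : ∃ R : ℕ, C * Real.exp (-κ * R) < ε := by
      have h1 : Tendsto (fun R : ℕ => C * Real.exp (-κ * R)) atTop (nhds (C * 0)) := by
        refine tendsto_const_nhds.mul ?_
        have : Tendsto (fun R : ℕ => -κ * (R : ℝ)) atTop atBot :=
          (tendsto_natCast_atTop_atTop).const_mul_atTop_of_neg (by linarith)
        exact Real.tendsto_exp_atBot.comp this
      rw [mul_zero] at h1
      exact (h1.eventually (gt_mem_nhds hε)).exists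
    refine (finite_box (R : ℤ)).subset (fun x hx => ?_) |> Filter.eventually_cofinite.2
    -- `x` outside the eventual set has a large coordinate
    simp only [Set.mem_setOf_eq, not_lt] at hx ⊢
    by_contra hbox
    obtain ⟨i, hi⟩ := not_forall.1 hbox
    rw [not_le] at hi
    have hxi : x i ≠ 0 := by
      intro h0; rw [h0, abs_zero] at hi
      omega
    have h1 := hdecay x i hxi
    have h2 : C * Real.exp (-κ * |(x i : ℝ)|) ≤ C * Real.exp (-κ * R) := by
      refine mul_le_mul_of_nonneg_left (Real.exp_le_exp.2 ?_) hC
      have : (R : ℝ) ≤ |(x i : ℝ)| := by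
        rw [← Int.cast_abs]; exact_mod_cast hi.le
      nlinarith
    rw [Real.dist_eq, sub_zero] at hx
    linarith
  -- the atoms: Thm. 3.23 (1) and uniqueness
  have hw1 : (Pi.single 1 1 : ℕ → ℝ) 1 = 1 := by simp
  have hw : ∀ k, 2 ≤ k → k ≤ N → 0 ≤ (Pi.single 1 1 : ℕ → ℝ) k := by
    intro k hk _; simp [show k ≠ 1 by omega]
  obtain ⟨c₀, cπ, -, -, hc, hc', hR⟩ := thermodynamicLimit_twoPoint_decomp_of_hasLog Ls hν hN
    (hasLog_njl N) (njlBondCoeff_zero N) hw1 hw hm.le hev hLs hT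
  have hdiff : Tendsto (fun x : Site ν => (s ^ 2 - c₀) + cπ * latSgn x) cofinite (nhds 0) := by
    have := hR.sub hRL
    rw [sub_zero] at this
    refine this.congr fun x => ?_
    ring
  obtain ⟨h1, h2⟩ := eq_zero_of_tendsto_const_add_mul_latSgn hν1 hdiff
  have hc0 : c₀ = s ^ 2 := by linarith
  subst hc0
  rw [h2, neg_zero] at hc'
  exact ⟨T, s, hT, hS, hc, hc', ⟨κ, hκ, C, hC, hdecay⟩, hRL⟩

end ComplexSpin

end Literature.MathematicalPhysics.StatisticalMechanics

end
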